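import Mathlib
import Summits.Ventures.PercRepro.TriangleCapZoneWrap
import Summits.Ventures.PercRepro.TriangleCapZoneExact

/-!
# PercRepro — ONE BELOW THE THRESHOLD AT `r = 2`, EVERY `D ≥ 4`: THE BOTTOM AT `m = D` IS THE BIPARTITE VALUE
(p3, gen 56; part 330)

The structural bounds of part 326 freed from the wide-regime hypothesis: at `I = r` every graph of the band (any
`D ≥ 2 r`, `m ≤ D + r − 2`) has `2 j + 2 t (D − 1) + 2 (r − 1)(r − 2) ≥ t (t − 1) + 2 r (D − r)`
(`zone_bound_I_eq_r`), and at `I = D − r` (`D > 2 r`) it has `2 j + 2 t (D − 1) ≥ t (t − 1) + 2 (D − r) + 2 (D − 1)`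
(`zone_bound_I_eq_Dr`: the columns sum to `(m + 1) D`, an inside edge cannot have two full ends, one partial end
`v` and the rest `≡ D − v` cost `2 v (D − v) ≥ 2 (D − 1)` (`column_loss_zero`); two partial rows cost the same).
With the regime-free arithmetic of part 329 this settles `r = 2` for EVERY `D ≥ 4`: at `m = D`, `t = D² + 2`,
the bottom of the deep sub-band on all graphs is the bipartite value `C(t,2) − t (D − 1) + 2 (D − 2)`
(`zone_two_bound`, `zone_two_exact_all`) — the census cells `(4, 18)` and `(5, 27)` of §10dq(h) as theorems.
Axioms: standard.
-/

namespace PercRepro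

namespace TriangleCap

namespace C047

open Finset

variable {V : Type*} [Fintype V] [DecidableEq V]

/-- **THE COLUMN LOSS AT THE RESIDUE `0`:** values `c ≤ D` on `s` with `Σ c ≡ 0 (mod D)` and a member `x` with
`1 ≤ c(x) ≤ D − 1`: `2 (D − 1) ≤ Σ c (D − c)`. -/
theorem column_loss_zero {ι : Type*} [DecidableEq ι] (s : Finset ι) (c : ι → ℕ) (D : ℕ) (hD : 2 ≤ D)
    (hc : ∀ i ∈ s, c i ≤ D) (x : ι) (hx : x ∈ s) (h1 : 1 ≤ c x) (h2 : c x + 1 ≤ D)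
    (hsum : (∑ i ∈ s, c i) % D = 0) : 2 * (D - 1) ≤ ∑ i ∈ s, c i * (D - c i) := by
  rw [← sum_erase_add s _ hx] at hsum
  rw [← sum_erase_add s (fun i => c i * (D - c i)) hx]
  have hrest := sum_mul_sub_ge_phi (s.erase x) c D (fun i hi => hc i (mem_of_mem_erase hi))
  have hD0 : 0 < D := by omega
  -- the rest `≡ D − c x`
  have hres : (∑ i ∈ s.erase x, c i) % D = D - c x := by
    have hlt := Nat.mod_lt (∑ i ∈ s.erase x, c i) hD0
    have hm := mod_three_cases ((∑ i ∈ s.erase x, c i) % D + c x) D (by omega)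
    have h0 : ((∑ i ∈ s.erase x, c i) % D + c x) % D = 0 := by
      rw [Nat.mod_add_mod]
      exact hsum
    omega
  rw [phiD_mod, hres, phiD_of_lt D _ (by omega)] at hrest
  have e : D - (D - c x) = c x := by omega
  rw [e] at hrest
  have hp := partial_cost D (c x) h1 h2
  nlinarith [hrest, hp]

/-- **THE BOUND AT `I = r` (any `D ≥ 2 r`, `m ≤ D + r − 2`):** with exactly `r` inside edges every graph of the band has
`t (t − 1) + 2 r (D − r) ≤ 2 j + 2 t (D − 1) + 2 (r − 1)(r − 2)`. -/
theorem zone_bound_I_eq_r (H : SimpleGraph V) [DecidableRel H.Adj] (hfree : H.CliqueFree 3) (s m r D j : ℕ)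
    (hr : 2 ≤ r) (h2 : 2 * r ≤ D) (hm : m + 2 ≤ D + r) (hs : H.edgeFinset.card = s) (w : V)
    (hw : deg H w + (m * D + r) = s) (hw1 : 1 ≤ deg H w)
    (hj : ∑ v, deg H v * deg H v + 2 * ((m * D + r) * (s - (m * D + r) - 1)) + 2 * j = s * (s + 1))
    (hD : ∀ v, offDeg H w v ≤ D) (hIr : (insideEdges H w).card = r) :
    (m * D + r) * (m * D + r - 1) + 2 * (r * (D - r)) ≤
      2 * j + 2 * ((m * D + r) * (D - 1)) + 2 * ((r - 1) * (r - 2)) := by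
  set t := m * D + r with ht
  have hD0 : 0 < D := by omega
  have hmod : t % D = r := by
    rw [ht, Nat.add_comm, Nat.add_mul_mod_self_right, Nat.mod_eq_of_lt (by omega)]
  have hdef := deficiency_identity_split H hfree s t j D hs w hw hw1 hj hD
  have hoff : (offEdges H w).card = t := by
    have := card_offEdges_add_deg H w
    omega
  have hatt := attach_add_card_inside H hfree w
  rw [hoff] at hatt
  have hsumcol := sum_offDeg_nonNbrs_eq_add_card_inside H hfree w
  rw [hoff] at hsumcol
  have hsumrow : ∑ y ∈ univ.filter (fun y => H.Adj w y), offDeg H w y = t - (insideEdges H w).card := by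
    unfold attach at hatt
    omega
  have hcol := sum_mul_sub_ge_phi (nonNbrs H w) (offDeg H w) D (fun x _ => hD x)
  rw [hsumcol] at hcol
  rw [hIr] at hdef hcol hsumcol hsumrow
  have hphi : phiD D (2 * r) = 2 * r * (D - 2 * r) := phiD_two_mul_of_le D r h2
  have hphi1 : phiD D (t + r) = 2 * r * (D - 2 * r) := by
    rw [phiD_mod, Nat.add_mod, hmod, Nat.mod_eq_of_lt (by omega : r < D), ← two_mul, ← phiD_mod, hphi]
  have hbridge : 2 * r + (2 * r * (D - 2 * r) + (4 * r - 2)) + 2 * ((r - 1) * (r - 2)) = 2 * (r * (D - r)) + 2 := by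
    obtain ⟨u, rfl⟩ : ∃ u, D = 2 * r + u := ⟨D - 2 * r, by omega⟩
    obtain ⟨r', rfl⟩ : ∃ r', r = r' + 2 := ⟨r - 2, by omega⟩
    have e1 : 2 * (r' + 2) + u - 2 * (r' + 2) = u := by omega
    have e2 : r' + 2 - 1 = r' + 1 := by omega
    have e3 : r' + 2 - 2 = r' := by omega
    have e4 : 2 * (r' + 2) + u - (r' + 2) = r' + 2 + u := by omega
    have e5 : 4 * (r' + 2) - 2 = 4 * r' + 6 := by omega
    rw [e1, e2, e3, e4, e5]
    ring
  rw [hphi1] at hcol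
  suffices hsuff : 2 * r * (D - 2 * r) + (4 * r - 2) ≤
      ∑ x ∈ nonNbrs H w, offDeg H w x * (D - offDeg H w x) +
        ∑ y ∈ univ.filter (fun y => H.Adj w y), offDeg H w y * (D - offDeg H w y) by
    omega
  set P := (univ.filter (fun y => H.Adj w y)).filter (fun y => 1 ≤ offDeg H w y ∧ offDeg H w y < D) with hP
  rcases Nat.lt_or_ge P.card 2 with hP2 | hP2
  swap
  · obtain ⟨y₁, hy₁, y₂, hy₂, hne⟩ := one_lt_card.mp hP2
    have hsub : ({y₁, y₂} : Finset V) ⊆ univ.filter (fun y => H.Adj w y) := by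
      intro y hy
      rw [mem_insert, mem_singleton] at hy
      rcases hy with rfl | rfl
      · exact (mem_filter.mp hy₁).1
      · exact (mem_filter.mp hy₂).1
    have hle := sum_le_sum_of_subset (f := fun y => offDeg H w y * (D - offDeg H w y)) hsub
    rw [sum_pair hne] at hle
    have c1 := partial_cost D (offDeg H w y₁) (mem_filter.mp hy₁).2.1 (mem_filter.mp hy₁).2.2
    have c2 := partial_cost D (offDeg H w y₂) (mem_filter.mp hy₂).2.1 (mem_filter.mp hy₂).2.2
    omega
  have hrows0 : ∀ y ∈ univ.filter (fun y => H.Adj w y), offDeg H w y = 0 ∨ offDeg H w y = D := by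
    rcases Nat.lt_or_ge P.card 1 with h0 | h1
    · intro y hy
      by_contra hne
      rw [not_or] at hne
      have hyP : y ∈ P := mem_filter.mpr ⟨hy, by omega, by have := hD y; omega⟩
      have := card_pos.mpr ⟨y, hyP⟩
      omega
    · exfalso
      have hc1 : P.card = 1 := by omega
      obtain ⟨y₀, hy₀⟩ := card_eq_one.mp hc1
      have hy₀P : y₀ ∈ P := by
        rw [hy₀]
        exact mem_singleton_self _
      rw [mem_filter] at hy₀P
      have hothers : ∀ y ∈ (univ.filter (fun y => H.Adj w y)).erase y₀, offDeg H w y = 0 ∨ offDeg H w y = D := by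
        intro y hy
        rw [mem_erase] at hy
        by_contra hne
        rw [not_or] at hne
        have hyP : y ∈ P := mem_filter.mpr ⟨hy.2, by omega, by have := hD y; omega⟩
        rw [hy₀, mem_singleton] at hyP
        exact hy.1 hyP
      have hsum := sum_eq_mul_card_of_zero_or ((univ.filter (fun y => H.Adj w y)).erase y₀) (offDeg H w) D hothers
      have hsplit := sum_erase_add (univ.filter (fun y => H.Adj w y)) (offDeg H w) hy₀P.1
      rw [hsumrow, hsum] at hsplit
      have e : t - r = D * m := by
        rw [ht, Nat.add_sub_cancel, Nat.mul_comm]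
      rw [e] at hsplit
      obtain ⟨F, hF⟩ : ∃ F, D * F + offDeg H w y₀ = D * m := ⟨_, hsplit⟩
      have hm' : (D * F + offDeg H w y₀) % D = (D * m) % D := by rw [hF]
      rw [Nat.mul_add_mod, Nat.mod_eq_of_lt hy₀P.2.2, Nat.mul_mod_right] at hm'
      omega
  have hfull : (univ.filter (fun y => H.Adj w y ∧ offDeg H w y = D)).card = m := by
    have hsum := sum_eq_mul_card_of_zero_or (univ.filter (fun y => H.Adj w y)) (offDeg H w) D hrows0
    rw [hsumrow, filter_filter] at hsum
    have e : t - r = D * m := by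
      rw [ht, Nat.add_sub_cancel, Nat.mul_comm]
    rw [e] at hsum
    exact (Nat.eq_of_mul_eq_mul_left hD0 hsum).symm
  have hactive : (univ.filter (fun y => H.Adj w y ∧ 1 ≤ offDeg H w y)).card = m := by
    rw [← hfull]
    congr 1
    apply filter_congr
    intro y _
    constructor
    · rintro ⟨h1, h1'⟩
      refine ⟨h1, ?_⟩
      rcases hrows0 y (mem_filter.mpr ⟨mem_univ _, h1⟩) with h | h
      · omega
      · exact h
    · rintro ⟨h1, h1'⟩
      exact ⟨h1, by omega⟩
  obtain ⟨x, hx, x', hx', hxx'⟩ := exists_adj_nonNbrs H w (by omega)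
  have hnb := nbrDeg_add_nbrDeg_le_active H hfree w x x' hx hx' hxx'
  rw [hactive] at hnb
  have hin := inDeg_add_inDeg_le_inside_succ H w x x' hx hx' hxx'
  rw [hIr] at hin
  have hcx := offDeg_eq_nbrDeg_add_inDeg H w x hx
  have hcx' := offDeg_eq_nbrDeg_add_inDeg H w x' hx'
  have hin1 : 1 ≤ inDeg H w x := by
    unfold inDeg
    exact card_pos.mpr ⟨x', mem_filter.mpr ⟨hx', hxx'⟩⟩
  have hin1' : 1 ≤ inDeg H w x' := by
    unfold inDeg
    exact card_pos.mpr ⟨x, mem_filter.mpr ⟨hx, H.adj_symm hxx'⟩⟩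
  have hcolsum : (∑ x ∈ nonNbrs H w, offDeg H w x) % D = (2 * r) % D := by
    rw [hsumcol]
    have e : t + r = D * m + 2 * r := by
      rw [ht, Nat.mul_comm D m]
      ring
    rw [e, Nat.mul_add_mod]
  have hloss := column_loss (nonNbrs H w) (offDeg H w) D r (by omega) h2 (fun z _ => hD z) x x' hx hx'
    (H.ne_of_adj hxx') (by omega) (by omega) (by omega) hcolsum
  rw [hphi] at hloss
  omega

/-- **THE BOUND AT `I = D − r` (`2 r < D`, `m ≤ D + r − 2`):** with exactly `D − r` inside edges every graph of the
band has `t (t − 1) + 2 (D − r) + 2 (D − 1) ≤ 2 j + 2 t (D − 1)`. -/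
theorem zone_bound_I_eq_Dr (H : SimpleGraph V) [DecidableRel H.Adj] (hfree : H.CliqueFree 3) (s m r D j : ℕ)
    (hr : 1 ≤ r) (h2 : 2 * r + 1 ≤ D) (hm : m + 2 ≤ D + r) (hs : H.edgeFinset.card = s) (w : V)
    (hw : deg H w + (m * D + r) = s) (hw1 : 1 ≤ deg H w)
    (hj : ∑ v, deg H v * deg H v + 2 * ((m * D + r) * (s - (m * D + r) - 1)) + 2 * j = s * (s + 1))
    (hD : ∀ v, offDeg H w v ≤ D) (hIr : (insideEdges H w).card = D - r) :
    (m * D + r) * (m * D + r - 1) + 2 * (D - r) + 2 * (D - 1) ≤ 2 * j + 2 * ((m * D + r) * (D - 1)) := by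
  set t := m * D + r with ht
  have hD0 : 0 < D := by omega
  have hdef := deficiency_identity_split H hfree s t j D hs w hw hw1 hj hD
  have hoff : (offEdges H w).card = t := by
    have := card_offEdges_add_deg H w
    omega
  have hatt := attach_add_card_inside H hfree w
  rw [hoff] at hatt
  have hsumcol := sum_offDeg_nonNbrs_eq_add_card_inside H hfree w
  rw [hoff] at hsumcol
  have hsumrow : ∑ y ∈ univ.filter (fun y => H.Adj w y), offDeg H w y = t - (insideEdges H w).card := by
    unfold attach at hatt
    omega
  rw [hIr] at hdef hsumcol hsumrow
  -- `Σ_col = (m + 1) D`, `Σ_row = (m − 1) D + 2 r`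
  have hcolD : (∑ x ∈ nonNbrs H w, offDeg H w x) % D = 0 := by
    rw [hsumcol]
    have e : t + (D - r) = D * (m + 1) := by
      rw [ht]
      have : D * (m + 1) = m * D + D := by ring
      rw [this]
      omega
    rw [e, Nat.mul_mod_right]
  suffices hsuff : 2 * (D - 1) ≤
      ∑ x ∈ nonNbrs H w, offDeg H w x * (D - offDeg H w x) +
        ∑ y ∈ univ.filter (fun y => H.Adj w y), offDeg H w y * (D - offDeg H w y) by
    omega
  set P := (univ.filter (fun y => H.Adj w y)).filter (fun y => 1 ≤ offDeg H w y ∧ offDeg H w y < D) with hP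
  rcases Nat.lt_or_ge P.card 2 with hP2 | hP2
  swap
  · -- two partial rows
    obtain ⟨y₁, hy₁, y₂, hy₂, hne⟩ := one_lt_card.mp hP2
    have hsub : ({y₁, y₂} : Finset V) ⊆ univ.filter (fun y => H.Adj w y) := by
      intro y hy
      rw [mem_insert, mem_singleton] at hy
      rcases hy with rfl | rfl
      · exact (mem_filter.mp hy₁).1
      · exact (mem_filter.mp hy₂).1
    have hle := sum_le_sum_of_subset (f := fun y => offDeg H w y * (D - offDeg H w y)) hsub
    rw [sum_pair hne] at hle
    have c1 := partial_cost D (offDeg H w y₁) (mem_filter.mp hy₁).2.1 (mem_filter.mp hy₁).2.2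
    have c2 := partial_cost D (offDeg H w y₂) (mem_filter.mp hy₂).2.1 (mem_filter.mp hy₂).2.2
    omega
  -- at most one partial row: then exactly one (`Σ_row ≡ 2 r`), and at most `m` active rows
  have hactive : (univ.filter (fun y => H.Adj w y ∧ 1 ≤ offDeg H w y)).card ≤ m := by
    have hsplit : univ.filter (fun y => H.Adj w y ∧ 1 ≤ offDeg H w y) ⊆
        univ.filter (fun y => H.Adj w y ∧ offDeg H w y = D) ∪ P := by
      intro y hy
      rw [mem_filter] at hy
      rw [mem_union, mem_filter, hP, mem_filter, mem_filter]
      have := hD y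
      by_cases h : offDeg H w y = D
      · exact Or.inl ⟨mem_univ _, hy.2.1, h⟩
      · exact Or.inr ⟨⟨mem_univ _, hy.2.1⟩, hy.2.2, by omega⟩
    have hfull : (univ.filter (fun y => H.Adj w y ∧ offDeg H w y = D)).card + 1 ≤ m := by
      have hsub : univ.filter (fun y => H.Adj w y ∧ offDeg H w y = D) ⊆ univ.filter (fun y => H.Adj w y) := by
        intro y hy
        rw [mem_filter] at hy ⊢
        exact ⟨hy.1, hy.2.1⟩
      have hle := sum_le_sum_of_subset (f := offDeg H w) hsub
      rw [sum_const_nat (m := D) (fun y hy => (mem_filter.mp hy).2.2), hsumrow] at hle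
      have hlt : t - (D - r) < m * D := by
        rw [ht]
        omega
      have : (univ.filter (fun y => H.Adj w y ∧ offDeg H w y = D)).card * D < m * D := by omega
      have := Nat.lt_of_mul_lt_mul_right this
      omega
    have := card_le_card hsplit
    have := card_union_le (univ.filter (fun y => H.Adj w y ∧ offDeg H w y = D)) P
    omega
  -- the inside edge: not both ends full
  obtain ⟨x, hx, x', hx', hxx'⟩ := exists_adj_nonNbrs H w (by omega)
  have hnb := nbrDeg_add_nbrDeg_le_active H hfree w x x' hx hx' hxx'
  have hin := inDeg_add_inDeg_le_inside_succ H w x x' hx hx' hxx'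
  rw [hIr] at hin
  have hcx := offDeg_eq_nbrDeg_add_inDeg H w x hx
  have hcx' := offDeg_eq_nbrDeg_add_inDeg H w x' hx'
  have hin1 : 1 ≤ inDeg H w x := by
    unfold inDeg
    exact card_pos.mpr ⟨x', mem_filter.mpr ⟨hx', hxx'⟩⟩
  have hin1' : 1 ≤ inDeg H w x' := by
    unfold inDeg
    exact card_pos.mpr ⟨x, mem_filter.mpr ⟨hx, H.adj_symm hxx'⟩⟩
  have hDx := hD x
  have hDx' := hD x'
  rcases Nat.lt_or_ge (offDeg H w x) D with hxlt | hxge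
  · have := column_loss_zero (nonNbrs H w) (offDeg H w) D (by omega) (fun z _ => hD z) x hx (by omega) (by omega)
      hcolD
    omega
  · have hx'lt : offDeg H w x' < D := by omega
    have := column_loss_zero (nonNbrs H w) (offDeg H w) D (by omega) (fun z _ => hD z) x' hx' (by omega)
      (by omega) hcolD
    omega

/-- **`r = 2`, `m = D`, every `D ≥ 4`:** every graph of the band has `t (t − 1) + 4 (D − 2) ≤ 2 j + 2 t (D − 1)`,
`t = D² + 2`. -/
theorem zone_two_bound (H : SimpleGraph V) [DecidableRel H.Adj] (hfree : H.CliqueFree 3) (s D j : ℕ) (hD : 4 ≤ D)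
    (hs : H.edgeFinset.card = s) (w : V) (hw : deg H w + (D * D + 2) = s) (hw1 : 1 ≤ deg H w)
    (hj : ∑ v, deg H v * deg H v + 2 * ((D * D + 2) * (s - (D * D + 2) - 1)) + 2 * j = s * (s + 1))
    (hDle : ∀ v, offDeg H w v ≤ D) :
    (D * D + 2) * (D * D + 2 - 1) + 2 * (2 * (D - 2)) ≤ 2 * j + 2 * ((D * D + 2) * (D - 1)) := by
  rcases Nat.lt_or_ge D 6 with hD6 | hD6
  swap
  · have := zone_one_below_bound H hfree s D 2 D j (by omega) (by omega) (by omega) hs w hw hw1 hj hDle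
    have e : 2 * ((2 - 1) * (2 - 2)) = 0 := by norm_num
    rw [e] at this
    omega
  -- `D ∈ {4, 5}`: the cases on the number of inside edges
  have hD0 : 0 < D := by omega
  have hmod : (D * D + 2) % D = 2 := by
    rw [Nat.add_comm, Nat.add_mul_mod_self_right, Nat.mod_eq_of_lt (by omega)]
  have hdef := deficiency_identity_split H hfree s (D * D + 2) j D hs w hw hw1 hj hDle
  have hoff : (offEdges H w).card = D * D + 2 := by
    have := card_offEdges_add_deg H w
    omega
  have hatt := attach_add_card_inside H hfree w
  rw [hoff] at hatt
  have hsumcol := sum_offDeg_nonNbrs_eq_add_card_inside H hfree w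
  rw [hoff] at hsumcol
  have hsumrow : ∑ y ∈ univ.filter (fun y => H.Adj w y), offDeg H w y = D * D + 2 - (insideEdges H w).card := by
    unfold attach at hatt
    omega
  have hIt : (insideEdges H w).card ≤ D * D + 2 := by omega
  have hcol := sum_mul_sub_ge_phi (nonNbrs H w) (offDeg H w) D (fun x _ => hDle x)
  have hrow := sum_mul_sub_ge_phi (univ.filter (fun y => H.Adj w y)) (offDeg H w) D (fun y _ => hDle y)
  rw [hsumcol] at hcol
  rw [hsumrow] at hrow
  rcases Nat.lt_or_ge (insideEdges H w).card 2 with hIlt | hIge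
  · have := residue_one_below_lt D (D * D + 2) (insideEdges H w).card hIt (by omega) (by omega) (by omega)
    rw [hmod] at this
    omega
  rcases Nat.eq_or_lt_of_le hIge with hIeq | hIgt
  · have := zone_bound_I_eq_r H hfree s D 2 D j (by omega) (by omega) (by omega) hs w hw hw1 hj hDle hIeq.symm
    have e : 2 * ((2 - 1) * (2 - 2)) = 0 := by norm_num
    rw [e] at this
    omega
  rcases Nat.lt_or_ge (insideEdges H w).card (D - 1) with hIw | hIw
  · -- `I = D − 2` (only `D = 5`, `I = 3`)
    have hI3 : (insideEdges H w).card = D - 2 := by omega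
    have := zone_bound_I_eq_Dr H hfree s D 2 D j (by omega) (by omega) (by omega) hs w hw hw1 hj hDle hI3
    omega
  · -- `I ≥ D − 1 = D − r + 1`: the wrap arithmetic
    have := residue_one_below_wrap D (D * D + 2) (insideEdges H w).card hIt (by omega) (by omega) (by omega)
    rw [hmod] at this
    omega

/-- **THE EXACT BOTTOM AT `r = 2`, `m = D`, EVERY `D ≥ 4`:** on `ℓ + 1 + (s − t)` vertices, `t = D² + 2`, `D + 1 ≤ ℓ`,
`2 t ≤ s`, the bottom of the deep sub-band `u = t − D` on all graphs is the bipartite value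
`C(t,2) − t (D − 1) + 2 (D − 2)`: every graph has `t (t − 1) + 4 (D − 2) ≤ 2 j + 2 t (D − 1)` and the star family
with one inside edge attains it. -/
theorem zone_two_exact_all (s ℓ D : ℕ) (hD : 4 ≤ D) (hmℓ : D + 1 ≤ ℓ) (hs : 2 * (D * D + 2) ≤ s) :
    (∀ (H : SimpleGraph (Fin (ℓ + 1 + (s - (D * D + 2))))) [DecidableRel H.Adj], H.CliqueFree 3 →
      H.edgeFinset.card = s → ∀ w, deg H w + (D * D + 2) = s → (∀ v, offDeg H w v ≤ D) →
      ∀ j, ∑ v, deg H v * deg H v + 2 * ((D * D + 2) * (s - (D * D + 2) - 1)) + 2 * j = s * (s + 1) →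
      (D * D + 2) * (D * D + 2 - 1) + 2 * (2 * (D - 2)) ≤ 2 * j + 2 * ((D * D + 2) * (D - 1))) ∧
    (∃ (H : SimpleGraph (Fin (ℓ + 1 + (s - (D * D + 2))))) (_ : DecidableRel H.Adj), H.CliqueFree 3 ∧
      H.edgeFinset.card = s ∧ ∃ w, deg H w + (D * D + 2) = s ∧ (∀ v, offDeg H w v ≤ D) ∧
        (∃ x, ¬ H.Adj w x ∧ offDeg H w x = D) ∧
        ∃ j, ∑ v, deg H v * deg H v + 2 * ((D * D + 2) * (s - (D * D + 2) - 1)) + 2 * j = s * (s + 1) ∧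
          2 * j + 2 * ((D * D + 2) * (D - 1)) = (D * D + 2) * (D * D + 2 - 1) + 2 * (2 * (D - 2))) := by
  refine ⟨fun H _ hfree hsH w hw hD' j hj => ?_, ?_⟩
  · have hw1 : 1 ≤ deg H w := by omega
    exact zone_two_bound H hfree s D j hD hsH w hw hw1 hj hD'
  · have h := zone_one_below_witness s ℓ D 2 D (by omega) (by omega) (by omega) hmℓ hs
    have e : 2 * ((2 - 1) * (2 - 2)) = 0 := by norm_num
    rw [e] at h
    simp only [add_zero] at h
    exact h

end C047

end TriangleCap

end PercRepro
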